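import Literature.Analysis.FluidPDE.DuchonRobertLocalBalancePressureProofs
import Literature.Analysis.FunctionSpaces.TorusEnstrophyOrthogonality
import HarnessLib

/-!
# Matrix-kernel mollification and Novack's scale balance for smooth tensor kernels

Topic: Analysis/FluidPDE. Support file for the discharge of the named fact
`Torus.novack2024_longAvg_balance` (`Literature.Analysis.FluidPDE.NovackLongitudinalBalance`;
M. Novack, *Scaling laws and exact results in turbulence*, Nonlinearity 37 (2024) 095002, §2,
Step 2, (last:one:L:L)). Novack's proof of the lines `• = L, T` of his Theorem 1 runs the
Duchon–Robert computation not for a scalar mollifier `φ^ε` but for **matrix-valued kernels**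
`T^{ij}_•(y) φ_{ℓ,γ}(y)` (op. cit. §2, (increments a–c), Step 0 and Step 2): the mollified velocity is
`u^i_{•} = ∫ u^j(x+y) T^{ij}(y) φ(y) dy`, the quadratic and cubic averages are
`(u^i_• u^i_• f) = ∫ u^j(x+y) T^{ij}(y) u^i(x+y) f(x+y) φ(y) dy`, and the flux produced by the
computation is `−½ ∫ ∂_{y_k}(T^{ij} φ)(y) δu^i δu^j δu^k dy` ((mess:one), first equality).

This file transcribes these objects on `T^d` for a **general smooth, even, symmetric matrix
kernel** `M = (M i j)_{i,j}` of scalar torus kernels (the matrix twin of the scalar objects of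
`Literature.Analysis.FluidPDE.DuchonRobertLocalBalance`: `Torus.vecConv`, `|u|² ⋆ K`,
`(|u|²u) ⋆ K`, `Torus.kernelFlux`, `Torus.symmTestField`), records the two printed steps of the
computation that involve the weak solution as **named facts** — the matrix cubic identity
`Torus.integral_matKernelFlux_mul_eq` ((mess:one), first equality: the matrix twin of the accepted
fact `Torus.integral_kernelFlux_mul_eq`) and the tested momentum equation
`Torus.IsDistributionalNSSolutionOn.matSymmTestField_identity` (Step 0, (eq:1) + (eq:2): the
matrix twin of the accepted fact `Torus.IsDistributionalNSSolutionOn.symmTestField_identity`) —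
and **proves** the slice-wise pressure step (Step 2, first display: when `∂ᵢ(T^{ik}φ) = ∂ₖ ζ̃` is a
gradient, the pressure only sees the cut-off): `Torus.divergence_matSymmTestField`,
`Torus.integral_mul_divergence_matSymmTestField` (its space–time form, with the `L^{3/2} × L³`
bookkeeping, is proved in `NovackMatrixKernelProofs`), together with the specialisation of the
objects to diagonal kernels `M = δ K` (`Torus.diagKernel`: `matConv_diagKernel`,
`matSymmTestField_diagKernel`, `matKernelFlux_diagKernel`).

## The objects (kernel `M i j : T^d → ℝ`, even: `M i j (−z) = M i j z`, symmetric: `M i j = M j i`)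

* `Torus.matConv v M x = (∑ⱼ (vⱼ ⋆ M i j)(x))ᵢ` — Novack's `u^i_M(x) = ∫ M^{ij}(y) u^j(x+y) dy`
  ((increments a); for an even kernel `∫ M^{ij}(y) u^j(x+y) dy = ∫ u^j(y) M^{ij}(x−y) dy`);
* `Torus.matConvSq v M x = ∑ᵢⱼ ((vᵢvⱼ) ⋆ M i j)(x)` — `(|u_M|²)(x) = ∫ ⟪u(x+y), M(y)u(x+y)⟫ dy`
  ((increments c) with `f = 1`);
* `Torus.matConvCube v M x = (∑ᵢⱼ ((vᵢvⱼvₖ) ⋆ M i j)(x))ₖ` — `(uᵏ|u_M|²)(x)` ((increments c),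
  `f = uᵏ`);
* `Torus.matKernelFlux M v x = ∫ ∑ᵢⱼₖ ∂ₖ(M i j)(z) δvᵢ δvⱼ δvₖ dz`, `δv = v(x+z) − v(x)` — the
  flux `∫ ∂_{y_k}(T^{ij}φ) δuⁱδuʲδuᵏ dy` of (mess:one);
* `Torus.matSymmTestField M χ v = χ u_M + (χ u)_M` — the sum of Novack's two test fields
  `(φ u)_{M}` ((eq:1)) and `φ u_M` ((eq:2));
* `Torus.matPairing T u p ψ M ζ` — twice the left-hand side of the scale balance (last:one:L)
  (`ν = 0`, `f = 0`) tested with a scalar `ψ` supported in `(0,T) × T^d`: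
  `2∫∫⟪u,u_M⟫∂ₜψ + 2∫∫⟪u,u_M⟫⟪u,∇ψ⟫ + ∫∫⟪(u|u_M|²),∇ψ⟫ − ∫∫(|u_M|²)⟪u,∇ψ⟫ + 2∫∫p⟪u_M,∇ψ⟫ + 2∫∫(p ⋆ ζ)⟪u,∇ψ⟫`,
  `ζ` the pressure potential of `M`.

For the scalar kernel `M i j = δᵢⱼ K` these are literally `vecConv v K`, `|v|² ⋆ K`,
`(|v|²v) ⋆ K`, `kernelFlux K v` and `symmTestField K χ v`.

## What is proved here and what is recorded

* `Torus.divergence_matSymmTestField` (**proved**): for `M` smooth with a smooth potential `ζ`,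
  `∑ᵢ ∂ᵢ(M i j) = ∂ⱼ ζ` (Novack's `∂ᵢ(T^{ik} φ) = ∂ₖ ζ̃`, first display of Step 2), an integrable
  weakly divergence-free `v` and a smooth cut-off `χ`,
  `div(χ v_M + (χv)_M) = ⟪v_M, ∇χ⟫ + ⟪v, ∇χ⟫ ⋆ ζ` (so that `∫ p div Φ = ∫ p⟪v_M,∇χ⟫ + ∫ (p ⋆ ζ)⟪v,∇χ⟫`
  for even `ζ`): `div v_M = ∑ⱼ vⱼ ⋆ ∂ⱼζ = 0` and `div (χv)_M = ∑ⱼ (χvⱼ) ⋆ ∂ⱼζ = ⟪v,∇χ⟫ ⋆ ζ` by weak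
  divergence-freeness (the accepted `Torus.sum_convolution_partialDeriv_eq_zero`,
  `Torus.sum_convolution_mul_partialDeriv_eq`).
* `Torus.integral_matKernelFlux_mul_eq` (**named fact**, (mess:one) first equality, "by direct
  computation, using that `∇·u = 0` … and the spherical symmetry of `φ T_•` and anti-symmetry of
  its gradient"): `∫∫ψ 𝒟_M(u) = ∫∫⟪(u|u_M|²),∇ψ⟫ − ∫∫(|u_M|²)⟪u,∇ψ⟫ + 2∫∫⟪u,u_M⟫⟪u,∇ψ⟫ − 2∫∫⟪u,(u·∇)Φ_M⟫`.
  Formal derivation (smooth `u`, `div u = 0`, `M` even symmetric, `F_M := ∫ M(y)F(x+y)dy`):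
  expanding `δuⁱδuʲδuᵏ` and integrating each monomial against `∂ₖM^{ij}(y) dy`,
  `∫∂ₖM^{ij}δuⁱδuʲδuᵏ dy = −div V_M + u·∇S_M + 2uʲ∂ₖW^{jk} − 2uʲuᵏ∂ₖu_Mʲ`
  (`V_Mᵏ = (uⁱuʲuᵏ)_{M^{ij}}`, `S_M = (uⁱuʲ)_{M^{ij}}`, `W^{jk} = (uⁱuᵏ)_{M^{ji}}`; the monomials
  `uⁱuʲu₊ᵏ`, `uⁱuʲuᵏ` drop by `div u = 0`, `∫∇M = 0`), while
  `∫⟪u,(u·∇)Φ_M⟫ = ∫⟪u,u_M⟫⟪u,∇ψ⟫ + ∫ψuʲuᵏ∂ₖu_Mʲ − ∫ψuⁱ∂ₖW^{ik}` (adjointness of `F ↦ F_M` for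
  even symmetric `M`); combining gives the display. For `M = δK` it is the accepted scalar fact.
* `Torus.IsDistributionalNSSolutionOn.matSymmTestField_identity` (**named fact**, Step 0: the weak
  formulation tested with `(φu)_M` ((eq:1)) and with `φ u_M` ((eq:2)) and added; for a weak
  solution the products `φ u` are reached by approximation, "we must justify passing to the limit
  `φₙⁱ → uⁱ` in each term", op. cit. Step 0 — the time-mollification argument of CCFS 2008, §3.1
  as formalised in the tree's `Torus.energyBalance_vecConv_holds`): with `Φ_M = ψu_M + (ψu)_M`,
  `∫∫⟪u,u_M⟫∂ₜψ + ∫∫⟪u,(u·∇)Φ_M⟫ + ν∫∫⟪u,ΔΦ_M⟫ + ∫∫p div Φ_M = 0` (the time pairing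
  `∫∫⟪u,∂ₜΦ_M⟫` equals `2∫∫⟪u,u_M⟫∂ₜψ + ∫∫ψ∂ₜ⟪u,u_M⟫ = ∫∫⟪u,u_M⟫∂ₜψ` by adjointness, `M` even and
  symmetric). For `M = δK` it is the accepted scalar fact.

## Design notes

* Matrix kernels are families `M : d → d → (T^d → ℝ)` of scalar torus kernels rather than
  `Matrix`-valued functions, so that the scalar convolution API (`⋆`, `partialDeriv_convolution`,
  adjointness and oddness lemmas of `TorusSpaceTimeConvolution` / `DuchonRobertCubicIdentity`)
  applies entrywise; symmetry and evenness are hypotheses of the facts, as printed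
  ("symmetric tensors" (tensors); "radially symmetric kernel").
* Hypothesis blocks of the two facts copy those of their scalar twins verbatim (`u ∈ L³_{t,x}`
  jointly measurable and weakly divergence free for a.e. `t`; for the tested equation a
  distributional solution with `p ∈ L^{3/2}_{t,x}`), with `K` replaced by `M`.
* Not here: the specific kernels of Novack's Step 2 (`|B_ℓ|⁻¹1_{B_ℓ}T_L − ζ_ℓ T_T` and its smooth
  approximants) and the limit `γ → 0`; they live in `NovackKernelFamily` /
  `NovackLongitudinalBalanceSteps`.

## References

* M. Novack, *Scaling laws and exact results in turbulence*, Nonlinearity 37 (2024) 095002,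
  arXiv:2310.01375: §1 (tensors); §2 (increments a–c), Step 0 ((setting:up), (eq:1), (eq:2)),
  Step 2 (potentials `ζ̃`, (withkappa), (last:one:L), (mess:one)); equation labels are the
  `\label`s of the arXiv source. [Novack2024]
* J. Duchon, R. Robert, Nonlinearity 13 (2000) 249–255, proof of Prop. 1 (the scalar
  computation). [DuchonRobert2000]
* A. Cheskidov, P. Constantin, S. Friedlander, R. Shvydkoy, Nonlinearity 21 (2008) 1233–1252,
  §3.1 (mollified solutions as test functions). [CCFS2008]
-/

noncomputable section

open MeasureTheory TopologicalSpace Set Function Filter Metric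
open _root_.Topology
open scoped ENNReal NNReal Convolution ContDiff InnerProductSpace RealInnerProductSpace

namespace Literature.Analysis.FluidPDE.Torus

variable {d : Type*} [Fintype d] [DecidableEq d]

/-! ## Mollification by a matrix kernel -/

section Objects

/-- **Mollification of a vector field by a matrix kernel** `M = (M i j)` of scalar torus kernels:
`(v_M)ᵢ(x) = ∑ⱼ (vⱼ ⋆ M i j)(x) = ∑ⱼ ∫ vⱼ(y) M i j (x − y) dy` — Novack's
`u^i_{•,ℓ,γ}(x) = ∫ u^j(x+y) T^{ij}_•(y) φ_{ℓ,γ}(y) dy` ((increments a)) for the even kernel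
`M^{ij} = T^{ij}_• φ_{ℓ,γ}` (evenness turns `∫ M(y)u(x+y) dy` into the group convolution). Junk:
Bochner convention `0` off integrability (never the case for `v ∈ L¹`, `M` continuous). [cite: Novack2024, Sect. 2 (increments a)] -/
def matConv (v : UnitAddTorus d → EuclideanSpace ℝ d) (M : d → d → UnitAddTorus d → ℝ) :
    UnitAddTorus d → EuclideanSpace ℝ d :=
  fun x => WithLp.toLp 2 fun i => ∑ j, ((fun y => v y j) ⋆ M i j) x

omit [DecidableEq d] in
/-- Components of the matrix mollification: `(matConv v M x) i = ∑ⱼ (vⱼ ⋆ M i j)(x)`. [folklore] -/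
@[simp]
theorem matConv_apply (v : UnitAddTorus d → EuclideanSpace ℝ d) (M : d → d → UnitAddTorus d → ℝ)
    (x : UnitAddTorus d) (i : d) : matConv v M x i = ∑ j, ((fun y => v y j) ⋆ M i j) x :=
  rfl

omit [DecidableEq d] in
/-- The matrix mollification of the zero field vanishes. [folklore] -/
@[simp]
theorem matConv_zero (M : d → d → UnitAddTorus d → ℝ) :
    matConv (0 : UnitAddTorus d → EuclideanSpace ℝ d) M = 0 := by
  funext x
  ext i
  have h0 : ∀ j, (fun y => (0 : UnitAddTorus d → EuclideanSpace ℝ d) y j) =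
      (0 : UnitAddTorus d → ℝ) := fun j => by
    funext y
    simp
  rw [matConv_apply]
  simp_rw [h0, zero_convolution]
  simp

/-- **The quadratic matrix average** `(|u_M|²)(x) = ∑ᵢⱼ ((vᵢ vⱼ) ⋆ M i j)(x)` — Novack's
`(u^i_• u^i_• f)_{ℓ,γ}(x) = ∫ u^j(x+y) T^{ij}_•(y) u^i(x+y) f(x+y) φ(y) dy` with `f = 1`
((increments c)), i.e. `∫ ⟪u(x+y), M(y) u(x+y)⟫ dy`. [cite: Novack2024, Sect. 2 (increments c)] -/
def matConvSq (v : UnitAddTorus d → EuclideanSpace ℝ d) (M : d → d → UnitAddTorus d → ℝ) :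
    UnitAddTorus d → ℝ :=
  fun x => ∑ i, ∑ j, ((fun y => v y i * v y j) ⋆ M i j) x

/-- **The cubic matrix average** `(uᵏ|u_M|²)(x) = ∑ᵢⱼ ((vᵢ vⱼ vₖ) ⋆ M i j)(x)` — Novack's
`(u^i_• u^i_• f)_{ℓ,γ}` with `f = uᵏ` ((increments c)), as a vector indexed by `k`. [cite: Novack2024, Sect. 2 (increments c)] -/
def matConvCube (v : UnitAddTorus d → EuclideanSpace ℝ d) (M : d → d → UnitAddTorus d → ℝ) :
    UnitAddTorus d → EuclideanSpace ℝ d :=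
  fun x => WithLp.toLp 2 fun k => ∑ i, ∑ j, ((fun y => v y i * v y j * v y k) ⋆ M i j) x

omit [DecidableEq d] in
/-- Components of the cubic matrix average. [folklore] -/
@[simp]
theorem matConvCube_apply (v : UnitAddTorus d → EuclideanSpace ℝ d)
    (M : d → d → UnitAddTorus d → ℝ) (x : UnitAddTorus d) (k : d) :
    matConvCube v M x k = ∑ i, ∑ j, ((fun y => v y i * v y j * v y k) ⋆ M i j) x :=
  rfl

/-- **The flux through a matrix kernel** of a velocity slice `v : T^d → ℝ^d`:
`𝒟_M(v)(x) = ∫_{T^d} ∑ᵢⱼₖ ∂ₖ(M i j)(z) δvᵢ δvⱼ δvₖ dz`, `δv = v(x+z) − v(x)` — the right-hand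
side `∫ ∂_{y_k}(T^{ij}_L φ_{ℓ,γ}) (δuⁱ)(δuʲ)(δuᵏ) dy` of Novack's (mess:one) (up to his factor
`−½`; for `M i j = δᵢⱼ K` this is the Duchon–Robert torus flux `Torus.kernelFlux K v x`).
Bochner integral in `z` (junk `0` off integrability). [cite: Novack2024, Sect. 2 Step 2 (mess:one)] -/
def matKernelFlux (M : d → d → UnitAddTorus d → ℝ) (v : UnitAddTorus d → EuclideanSpace ℝ d)
    (x : UnitAddTorus d) : ℝ :=
  ∫ z, ∑ i, ∑ j, ∑ k, FunctionSpaces.Torus.partialDeriv k (M i j) z *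
    ((v (x + z) - v x) i * (v (x + z) - v x) j * (v (x + z) - v x) k)

/-- The matrix flux of the zero field vanishes. [folklore] -/
@[simp]
theorem matKernelFlux_zero (M : d → d → UnitAddTorus d → ℝ) (x : UnitAddTorus d) :
    matKernelFlux M (0 : UnitAddTorus d → EuclideanSpace ℝ d) x = 0 := by
  simp [matKernelFlux]

/-- **The symmetric matrix-mollified test field** `Φ_M = χ · v_M + (χ v)_M`: the sum of the two
test fields of Novack's Step 0, `(φ u)_{•}` ((eq:1)) and `φ u_{•}` ((eq:2)), for the cut-off
`χ = φ(t, ·)` and the velocity slice `v = u(t, ·)` (matrix twin of `Torus.symmTestField`). [cite: Novack2024, Sect. 2 Step 0 (eq:1)–(eq:2)] -/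
def matSymmTestField (M : d → d → UnitAddTorus d → ℝ) (χ : UnitAddTorus d → ℝ)
    (v : UnitAddTorus d → EuclideanSpace ℝ d) : UnitAddTorus d → EuclideanSpace ℝ d :=
  fun x => χ x • matConv v M x + matConv (fun y => χ y • v y) M x

omit [DecidableEq d] in
/-- Unfolding `matSymmTestField`. [folklore] -/
theorem matSymmTestField_apply (M : d → d → UnitAddTorus d → ℝ) (χ : UnitAddTorus d → ℝ)
    (v : UnitAddTorus d → EuclideanSpace ℝ d) (x : UnitAddTorus d) :
    matSymmTestField M χ v x = χ x • matConv v M x + matConv (fun y => χ y • v y) M x :=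
  rfl

omit [DecidableEq d] in
/-- The symmetric test field of the zero velocity vanishes. [folklore] -/
@[simp]
theorem matSymmTestField_zero (M : d → d → UnitAddTorus d → ℝ) (χ : UnitAddTorus d → ℝ) :
    matSymmTestField M χ (0 : UnitAddTorus d → EuclideanSpace ℝ d) = 0 := by
  funext x
  have h0 : (fun y => χ y • (0 : UnitAddTorus d → EuclideanSpace ℝ d) y) = 0 := by
    funext y; simp
  rw [matSymmTestField_apply, h0, matConv_zero]
  simp

/-- **Novack's tested scale balance for a matrix kernel**, `𝒩_M(ψ)`: twice the left-hand side of
(last:one:L) (`ν = 0`, `f = 0`, datum/endpoint terms absent for `ψ` supported in `(0,T)`) with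
the derivatives moved onto the scalar test function `ψ`,
`𝒩_M(ψ) = 2∫₀ᵀ∫⟪u,u_M⟫∂ₜψ + 2∫₀ᵀ∫⟪u,u_M⟫⟪u,∇ψ⟫ + ∫₀ᵀ∫⟪(u|u_M|²),∇ψ⟫ − ∫₀ᵀ∫(|u_M|²)⟪u,∇ψ⟫
  + 2∫₀ᵀ∫ p⟪u_M,∇ψ⟫ + 2∫₀ᵀ∫ (p ⋆ ζ)⟪u,∇ψ⟫`,
where `ζ` is the pressure potential of `M` (`p_{ℓ,γ,•} = p ⋆ ζ̃`, "the convolution of `ζ̃` with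
`p`"). For the kernel of (you:ell:ell) it is `Torus.novackLongPairing`, for `δᵢⱼ|B_ℓ|⁻¹1_{B_ℓ}`
it is `Torus.novackBallPairing`. [cite: Novack2024, Sect. 2 Step 2 (last:one:L)] -/
def matPairing (T : ℝ) (u : ℝ → UnitAddTorus d → EuclideanSpace ℝ d) (p : ℝ → UnitAddTorus d → ℝ)
    (ψ : ℝ → UnitAddTorus d → ℝ) (M : d → d → UnitAddTorus d → ℝ) (ζ : UnitAddTorus d → ℝ) : ℝ :=
  2 * (∫ t in Ioo 0 T, ∫ x, ⟪u t x, matConv (u t) M x⟫ * FunctionSpaces.Torus.timeDeriv ψ t x) +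
    2 * (∫ t in Ioo 0 T, ∫ x,
      ⟪u t x, matConv (u t) M x⟫ * ⟪u t x, FunctionSpaces.Torus.gradient (ψ t) x⟫) +
    (∫ t in Ioo 0 T, ∫ x, ⟪matConvCube (u t) M x, FunctionSpaces.Torus.gradient (ψ t) x⟫) -
    (∫ t in Ioo 0 T, ∫ x, matConvSq (u t) M x * ⟪u t x, FunctionSpaces.Torus.gradient (ψ t) x⟫) +
    2 * (∫ t in Ioo 0 T, ∫ x, p t x * ⟪matConv (u t) M x, FunctionSpaces.Torus.gradient (ψ t) x⟫) +
    2 * (∫ t in Ioo 0 T, ∫ x, (p t ⋆ ζ) x * ⟪u t x, FunctionSpaces.Torus.gradient (ψ t) x⟫)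

end Objects

/-! ## The two printed steps involving the weak solution, as named facts -/

section Facts

/-- **Novack's matrix cubic identity** (Novack 2024, §2 Step 2, (mess:one), first equality: "by
direct computation, using that `∇·u = 0`, `⟨u, T_• u⟩ = ⟨T_• u, T_• u⟩`, and the spherical
symmetry of `φ_{ℓ,γ}T_•` and anti-symmetry of its gradient `∇(φ_{ℓ,γ}T_•)`, we may rewrite the
last term from (last:one:L) as `−½ ∫∫∫ φ ∂_{y_k}(T^{ij}_• φ_{ℓ,γ}) δuⁱ δuʲ δuᵏ dy dt dx`"; the
matrix twin of Duchon–Robert's cubic identity `Torus.integral_kernelFlux_mul_eq`). Transcription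
on `T^d × (0,T)`: for a jointly measurable `u ∈ L³((0,T) × T^d)`, weakly divergence free for
a.e. `t`, a smooth, even, symmetric matrix kernel `M` and a test function `ψ` supported in
`(0,T)`, with `u_M = matConv`, `(|u_M|²) = matConvSq`, `(u|u_M|²) = matConvCube`,
`Φ_M = ψ u_M + (ψ u)_M` (`matSymmTestField`) and the flux `𝒟_M` (`matKernelFlux`):
`∫₀ᵀ∫ 𝒟_M(u) ψ = ∫₀ᵀ∫ ⟪(u|u_M|²), ∇ψ⟫ − ∫₀ᵀ∫ (|u_M|²) ⟪u, ∇ψ⟫ + 2∫₀ᵀ∫ ⟪u, u_M⟫⟪u, ∇ψ⟫ − 2∫₀ᵀ∫ ⟪u, (u·∇)Φ_M⟫`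
(the transport and commutator terms of (last:one:L) moved onto `ψ`; derivation in the module
docstring). [cite: Novack2024, Sect. 2 Step 2 (mess:one)] -/
def integral_matKernelFlux_mul_eq : Prop :=
  ∀ {T : ℝ} {u : ℝ → UnitAddTorus d → EuclideanSpace ℝ d}
    (_hmeas : AEStronglyMeasurable (FunctionSpaces.Torus.stLift u) (volume.restrict (Ioo 0 T ×ˢ univ)))
    (_hu3 : ∫⁻ t in Ioo 0 T, ∫⁻ x, ‖u t x‖ₑ ^ 3 < ⊤)
    (_hdiv : ∀ᵐ t ∂(volume.restrict (Ioo 0 T)), FunctionSpaces.Torus.IsWeaklyDivFree (u t))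
    {M : d → d → UnitAddTorus d → ℝ} (_hM : ∀ i j, FunctionSpaces.Torus.IsSmooth (M i j))
    (_hMev : ∀ i j z, M i j (-z) = M i j z) (_hMsymm : ∀ i j, M i j = M j i)
    {ψ : ℝ → UnitAddTorus d → ℝ} (_hψ : FunctionSpaces.Torus.IsSpaceTimeTestIoo T ψ),
    ∫ t in Ioo 0 T, ∫ x, matKernelFlux M (u t) x * ψ t x =
      (∫ t in Ioo 0 T, ∫ x, ⟪matConvCube (u t) M x, FunctionSpaces.Torus.gradient (ψ t) x⟫) -
        (∫ t in Ioo 0 T, ∫ x,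
          matConvSq (u t) M x * ⟪u t x, FunctionSpaces.Torus.gradient (ψ t) x⟫) +
        2 * (∫ t in Ioo 0 T, ∫ x,
          ⟪u t x, matConv (u t) M x⟫ * ⟪u t x, FunctionSpaces.Torus.gradient (ψ t) x⟫) -
        2 * ∫ t in Ioo 0 T, ∫ x,
          ⟪u t x, FunctionSpaces.Torus.convect (u t) (matSymmTestField M (ψ t) (u t)) x⟫

/-- **The momentum equation tested with Novack's matrix-mollified fields** (Novack 2024, §2 Step 0:
the weak formulation (weak:formulation) tested with `(φ u)^i_{M} = ∫ φ(x+y)u^j(x+y)T^{ij}(y)φ_{ℓ,γ}(y) dy`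
((setting:up) with `φⁱ = φuⁱ`, i.e. (eq:1): "we claim that we can actually choose `φⁱ = φuⁱ` in
the above computation … we must justify passing to the limit `φₙⁱuⁱ` in each term") and with
`Uᵏ = φ u^k_{M}` ((you), (eq:2)), the two identities added; the justification for a weak solution
is the time-mollification argument of Cheskidov–Constantin–Friedlander–Shvydkoy 2008, §3.1, as
formalised for the tree's `Torus.energyBalance_vecConv_holds`; matrix twin of the accepted fact
`Torus.IsDistributionalNSSolutionOn.symmTestField_identity`). Transcription: for a distributional
(pressure-explicit, unforced) Navier–Stokes/Euler solution `(u, p)` on `T^d × (0,T)`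
(`Torus.IsDistributionalNSSolutionOn T ν 0 u p`) with `u ∈ L³_{t,x}`, `p ∈ L^{3/2}_{t,x}`, a
smooth, even, symmetric matrix kernel `M` and a scalar test function `ψ` supported in `(0,T)`,
the weak formulation holds for the field `Φ_M = ψ u_M + (ψ u)_M` (`matSymmTestField`, smooth in
space, not in time), its time-derivative pairing taking the value `∫₀ᵀ∫ ⟪u, u_M⟫ ∂ₜψ`
(`= ∫∫⟪u,∂ₜΦ_M⟫` for smooth `u`, by adjointness of `F ↦ F_M` for even symmetric `M`):
`∫₀ᵀ∫ ⟪u, u_M⟫ ∂ₜψ + ∫₀ᵀ∫ ⟪u, (u·∇)Φ_M⟫ + ν ∫₀ᵀ∫ ⟪u, ΔΦ_M⟫ + ∫₀ᵀ∫ p div Φ_M = 0`. [cite: Novack2024, Sect. 2 Step 0 (eq:1)–(eq:2)] -/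
def IsDistributionalNSSolutionOn.matSymmTestField_identity : Prop :=
  ∀ {T ν : ℝ} {u : ℝ → UnitAddTorus d → EuclideanSpace ℝ d} {p : ℝ → UnitAddTorus d → ℝ}
    (_hsol : IsDistributionalNSSolutionOn T ν 0 u p)
    (_hu3 : ∫⁻ t in Ioo 0 T, ∫⁻ x, ‖u t x‖ₑ ^ 3 < ⊤)
    (_hp : ∫⁻ t in Ioo 0 T, ∫⁻ x, ‖p t x‖ₑ ^ (3 / 2 : ℝ) < ⊤)
    {M : d → d → UnitAddTorus d → ℝ} (_hM : ∀ i j, FunctionSpaces.Torus.IsSmooth (M i j))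
    (_hMev : ∀ i j z, M i j (-z) = M i j z) (_hMsymm : ∀ i j, M i j = M j i)
    {ψ : ℝ → UnitAddTorus d → ℝ} (_hψ : FunctionSpaces.Torus.IsSpaceTimeTestIoo T ψ),
    (∫ t in Ioo 0 T, ∫ x, ⟪u t x, matConv (u t) M x⟫ * FunctionSpaces.Torus.timeDeriv ψ t x) +
      (∫ t in Ioo 0 T, ∫ x,
        ⟪u t x, FunctionSpaces.Torus.convect (u t) (matSymmTestField M (ψ t) (u t)) x⟫) +
      ν * (∫ t in Ioo 0 T, ∫ x,
        ⟪u t x, FunctionSpaces.Torus.laplacian (matSymmTestField M (ψ t) (u t)) x⟫) +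
      (∫ t in Ioo 0 T, ∫ x,
        p t x * FunctionSpaces.Torus.divergence (matSymmTestField M (ψ t) (u t)) x) = 0

end Facts

/-! ## The pressure step: divergence of the symmetric field when `div M` is a gradient -/

section Divergence

variable {M : d → d → UnitAddTorus d → ℝ} {ζ χ : UnitAddTorus d → ℝ}
  {v : UnitAddTorus d → EuclideanSpace ℝ d}

omit [DecidableEq d] in
/-- The components of the symmetric matrix field:
`(Φ_M)ᵢ = χ · ∑ⱼ (vⱼ ⋆ M i j) + ∑ⱼ ((χ vⱼ) ⋆ M i j)`. [folklore] -/
theorem matSymmTestField_apply_apply (M : d → d → UnitAddTorus d → ℝ) (χ : UnitAddTorus d → ℝ)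
    (v : UnitAddTorus d → EuclideanSpace ℝ d) (y : UnitAddTorus d) (i : d) :
    matSymmTestField M χ v y i =
      χ y * (∑ j, ((fun z => v z j) ⋆ M i j) y) + ∑ j, ((fun z => χ z * v z j) ⋆ M i j) y := by
  rw [matSymmTestField_apply, PiLp.add_apply, PiLp.smul_apply, smul_eq_mul, matConv_apply,
    matConv_apply]
  simp only [PiLp.smul_apply, smul_eq_mul]

/-- Partial derivatives of the components of the symmetric matrix field:
`∂ₖ(Φ_M)ᵢ = ∂ₖχ ∑ⱼ(vⱼ ⋆ M i j) + χ ∑ⱼ (vⱼ ⋆ ∂ₖM i j) + ∑ⱼ ((χvⱼ) ⋆ ∂ₖM i j)` for `v ∈ L¹`,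
`M`, `χ` smooth. [folklore] -/
theorem partialDeriv_matSymmTestField (hM : ∀ i j, FunctionSpaces.Torus.IsSmooth (M i j))
    (hχ : FunctionSpaces.Torus.IsSmooth χ) (hv : Integrable v volume) (k i : d) (x : UnitAddTorus d) :
    FunctionSpaces.Torus.partialDeriv k (fun y => matSymmTestField M χ v y i) x =
      FunctionSpaces.Torus.partialDeriv k χ x * (∑ j, ((fun z => v z j) ⋆ M i j) x) +
        χ x * (∑ j, ((fun z => v z j) ⋆ FunctionSpaces.Torus.partialDeriv k (M i j)) x) +
        ∑ j, ((fun z => χ z * v z j) ⋆ FunctionSpaces.Torus.partialDeriv k (M i j)) x := by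
  have hvj : ∀ j, Integrable (fun z => v z j) volume := fun j => hv.eval_piLp j
  have hχvj : ∀ j, Integrable (fun z => χ z * v z j) volume := fun j => hχ.integrable_smul (hvj j)
  have hs1 : ∀ j, FunctionSpaces.Torus.IsSmooth ((fun z => v z j) ⋆ M i j) := fun j =>
    FunctionSpaces.Torus.isSmooth_convolution (hvj j) (hM i j)
  have hs2 : ∀ j, FunctionSpaces.Torus.IsSmooth ((fun z => χ z * v z j) ⋆ M i j) := fun j =>
    FunctionSpaces.Torus.isSmooth_convolution (hχvj j) (hM i j)
  have hS1 : FunctionSpaces.Torus.IsSmooth (fun y => ∑ j, ((fun z => v z j) ⋆ M i j) y) := by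
    have hl : FunctionSpaces.Torus.lift (fun y => ∑ j, ((fun z => v z j) ⋆ M i j) y) =
        fun w => ∑ j, FunctionSpaces.Torus.lift ((fun z => v z j) ⋆ M i j) w := rfl
    unfold FunctionSpaces.Torus.IsSmooth
    rw [hl]
    exact ContDiff.sum fun j _ => hs1 j
  have hS2 : FunctionSpaces.Torus.IsSmooth (fun y => ∑ j, ((fun z => χ z * v z j) ⋆ M i j) y) := by
    have hl : FunctionSpaces.Torus.lift (fun y => ∑ j, ((fun z => χ z * v z j) ⋆ M i j) y) =
        fun w => ∑ j, FunctionSpaces.Torus.lift ((fun z => χ z * v z j) ⋆ M i j) w := rfl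
    unfold FunctionSpaces.Torus.IsSmooth
    rw [hl]
    exact ContDiff.sum fun j _ => hs2 j
  have hfun : (fun y => matSymmTestField M χ v y i) =
      (fun y => χ y * (∑ j, ((fun z => v z j) ⋆ M i j) y)) +
        fun y => ∑ j, ((fun z => χ z * v z j) ⋆ M i j) y := by
    funext y
    rw [Pi.add_apply, matSymmTestField_apply_apply]
  have hm : FunctionSpaces.Torus.IsContDiff 1 (fun y => χ y * (∑ j, ((fun z => v z j) ⋆ M i j) y)) :=
    (hχ.smul' hS1).isContDiff (by simp)
  rw [hfun, FunctionSpaces.Torus.partialDeriv_add hm (hS2.isContDiff (by simp)), Pi.add_apply,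
    FunctionSpaces.Torus.partialDeriv_mul (hχ.isContDiff (by simp)) (hS1.isContDiff (by simp)),
    FunctionSpaces.Torus.partialDeriv_finset_sum _ (fun j _ => (hs1 j).isContDiff (by simp)),
    FunctionSpaces.Torus.partialDeriv_finset_sum _ (fun j _ => (hs2 j).isContDiff (by simp))]
  simp_rw [FunctionSpaces.Torus.partialDeriv_convolution (hvj _) (hM i _),
    FunctionSpaces.Torus.partialDeriv_convolution (hχvj _) (hM i _)]
  ring

/-- **The pressure step of Novack's Step 2** (first display of Step 2: for the radially symmetric
matrix kernels `∂ᵢ(T^{ik}_• φ) = ∂ₖ ζ̃_•` "are gradients of potentials. Using this to simplify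
…", so that the pressure terms of (eq:1), (eq:2) become `∂ᵢφ (u^i_M p + uⁱ p_M)`, `p_M = p ⋆ ζ̃`).
For a smooth matrix kernel `M` with a smooth potential `ζ`, `∑ᵢ ∂ᵢ(M i j) = ∂ⱼ ζ` for all `j`,
an integrable weakly divergence-free `v` and a smooth cut-off `χ`, the symmetric field
`Φ_M = χ v_M + (χ v)_M` has `div Φ_M = ⟪v_M, ∇χ⟫ + ⟪v, ∇χ⟫ ⋆ ζ`: indeed
`div Φ_M = ⟪v_M,∇χ⟫ + χ ∑ⱼ vⱼ ⋆ ∂ⱼζ + ∑ⱼ (χvⱼ) ⋆ ∂ⱼζ` with `∑ⱼ vⱼ ⋆ ∂ⱼζ = 0` and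
`∑ⱼ (χvⱼ) ⋆ ∂ⱼζ = ⟪v,∇χ⟫ ⋆ ζ` by weak divergence-freeness (the accepted
`Torus.sum_convolution_partialDeriv_eq_zero`, `Torus.sum_convolution_mul_partialDeriv_eq`). [cite: Novack2024, Sect. 2 Step 2, potentials ζ̃] -/
theorem divergence_matSymmTestField (hM : ∀ i j, FunctionSpaces.Torus.IsSmooth (M i j))
    (hζ : FunctionSpaces.Torus.IsSmooth ζ)
    (hpot : ∀ j x, ∑ i, FunctionSpaces.Torus.partialDeriv i (M i j) x =
      FunctionSpaces.Torus.partialDeriv j ζ x)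
    (hχ : FunctionSpaces.Torus.IsSmooth χ) (hv : Integrable v volume)
    (hdiv : FunctionSpaces.Torus.IsWeaklyDivFree v) (x : UnitAddTorus d) :
    FunctionSpaces.Torus.divergence (matSymmTestField M χ v) x =
      ⟪matConv v M x, FunctionSpaces.Torus.gradient χ x⟫ +
        ((fun y => ⟪v y, FunctionSpaces.Torus.gradient χ y⟫) ⋆ ζ) x := by
  have hχ1 : FunctionSpaces.Torus.IsContDiff 1 χ := hχ.isContDiff (by simp)
  have hvj : ∀ j, Integrable (fun y => v y j) volume := fun j => hv.eval_piLp j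
  have hχvj : ∀ j, Integrable (fun y => χ y * v y j) volume := fun j => hχ.integrable_smul (hvj j)
  have hpotfun : ∀ j, (fun z => ∑ i, FunctionSpaces.Torus.partialDeriv i (M i j) z) =
      FunctionSpaces.Torus.partialDeriv j ζ := fun j => funext (hpot j)
  -- `∑ᵢ (f ⋆ ∂ᵢM i j) = f ⋆ ∂ⱼζ` for integrable `f`
  have hcol : ∀ {f : UnitAddTorus d → ℝ}, Integrable f volume → ∀ j,
      ∑ i, (f ⋆ FunctionSpaces.Torus.partialDeriv i (M i j)) x =
        (f ⋆ FunctionSpaces.Torus.partialDeriv j ζ) x := by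
    intro f hf j
    rw [← FunctionSpaces.Torus.convolution_finset_sum_right hf _
      (fun i _ => ((hM i j).partialDeriv i).continuous), hpotfun j]
  unfold FunctionSpaces.Torus.divergence
  simp_rw [partialDeriv_matSymmTestField hM hχ hv]
  rw [Finset.sum_add_distrib, Finset.sum_add_distrib]
  -- the three sums
  have h1 : ∑ i, FunctionSpaces.Torus.partialDeriv i χ x * ∑ j, ((fun z => v z j) ⋆ M i j) x =
      ⟪matConv v M x, FunctionSpaces.Torus.gradient χ x⟫ := by
    rw [PiLp.inner_apply]
    refine Finset.sum_congr rfl fun i _ => ?_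
    rw [RCLike.inner_apply, conj_trivial, FunctionSpaces.Torus.gradient_apply hχ1 x i, matConv_apply]
  have h2 : ∑ i, χ x * ∑ j, ((fun z => v z j) ⋆ FunctionSpaces.Torus.partialDeriv i (M i j)) x = 0 := by
    rw [← Finset.mul_sum, Finset.sum_comm]
    simp_rw [hcol (hvj _)]
    rw [sum_convolution_partialDeriv_eq_zero hv hdiv hζ, mul_zero]
  have h3 : ∑ i, ∑ j, ((fun z => χ z * v z j) ⋆ FunctionSpaces.Torus.partialDeriv i (M i j)) x =
      ((fun y => ⟪v y, FunctionSpaces.Torus.gradient χ y⟫) ⋆ ζ) x := by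
    rw [Finset.sum_comm]
    simp_rw [hcol (hχvj _)]
    exact sum_convolution_mul_partialDeriv_eq hζ hχ hv hdiv x
  rw [h1, h2, h3, add_zero]

omit [DecidableEq d] in
/-- The matrix mollification of an integrable field by a smooth kernel is continuous (indeed
smooth componentwise). [folklore] -/
theorem continuous_matConv (hM : ∀ i j, FunctionSpaces.Torus.IsSmooth (M i j))
    (hv : Integrable v volume) : Continuous (matConv v M) := by
  have hvj : ∀ j, Integrable (fun y => v y j) volume := fun j => hv.eval_piLp j
  have hVs : ∀ i, FunctionSpaces.Torus.IsSmooth fun y => matConv v M y i := fun i => by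
    have hl : FunctionSpaces.Torus.lift (fun y => matConv v M y i) =
        fun w => ∑ j, FunctionSpaces.Torus.lift ((fun z => v z j) ⋆ M i j) w := rfl
    unfold FunctionSpaces.Torus.IsSmooth
    rw [hl]
    exact ContDiff.sum fun j _ => FunctionSpaces.Torus.isSmooth_convolution (hvj j) (hM i j)
  have : matConv v M = fun y => (WithLp.equiv 2 (d → ℝ)).symm fun i => matConv v M y i := by
    funext y; rfl
  rw [this]
  exact (PiLp.continuous_toLp 2 _).comp (continuous_pi fun i => (hVs i).continuous)

/-- **The pressure pairing of the symmetric matrix field on one time slice** (Novack 2024, §2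
Step 2: the pressure terms `−∂ᵢφ (u^i_{•,ℓ,γ} p + uⁱ p_{ℓ,γ,•})` of (last:one:L),
`p_{ℓ,γ,•} = p ⋆ ζ̃`). Under the hypotheses of `divergence_matSymmTestField`, for an even
potential `ζ` and an integrable pressure slice `q`,
`∫ q div Φ_M = ∫ q ⟪v_M, ∇χ⟫ + ∫ (q ⋆ ζ) ⟪v, ∇χ⟫`
(both right-hand integrands are `q` times a continuous function; adjointness of mollification by
the even kernel `ζ`). [cite: Novack2024, Sect. 2 Step 2 (last:one:L)] -/
theorem integral_mul_divergence_matSymmTestField (hM : ∀ i j, FunctionSpaces.Torus.IsSmooth (M i j))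
    (hζ : FunctionSpaces.Torus.IsSmooth ζ) (hζev : ∀ z, ζ (-z) = ζ z)
    (hpot : ∀ j x, ∑ i, FunctionSpaces.Torus.partialDeriv i (M i j) x =
      FunctionSpaces.Torus.partialDeriv j ζ x)
    (hχ : FunctionSpaces.Torus.IsSmooth χ) (hv : Integrable v volume)
    (hdiv : FunctionSpaces.Torus.IsWeaklyDivFree v) {q : UnitAddTorus d → ℝ}
    (hq : Integrable q volume) :
    ∫ x, q x * FunctionSpaces.Torus.divergence (matSymmTestField M χ v) x =
      (∫ x, q x * ⟪matConv v M x, FunctionSpaces.Torus.gradient χ x⟫) +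
        ∫ x, (q ⋆ ζ) x * ⟪v x, FunctionSpaces.Torus.gradient χ x⟫ := by
  have hg : Integrable (fun y => ⟪v y, FunctionSpaces.Torus.gradient χ y⟫) volume :=
    FunctionSpaces.Torus.integrable_inner_of_continuous hv hχ.gradient.continuous
  have hAc : Continuous fun x => ⟪matConv v M x, FunctionSpaces.Torus.gradient χ x⟫ :=
    (continuous_matConv hM hv).inner hχ.gradient.continuous
  obtain ⟨CA, hCA⟩ := FunctionSpaces.Torus.exists_forall_norm_le_of_continuous hAc
  have hqA : Integrable (fun x => q x * ⟪matConv v M x, FunctionSpaces.Torus.gradient χ x⟫) volume :=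
    hq.mul_bdd hAc.aestronglyMeasurable (ae_of_all _ hCA)
  have hqB : Integrable (fun x => q x *
      ((fun y => ⟪v y, FunctionSpaces.Torus.gradient χ y⟫) ⋆ ζ) x) volume := by
    obtain ⟨C, hC⟩ := FunctionSpaces.Torus.exists_forall_norm_le_of_continuous
      (FunctionSpaces.Torus.continuous_convolution hg hζ.continuous)
    exact hq.mul_bdd ((FunctionSpaces.Torus.continuous_convolution hg hζ.continuous).aestronglyMeasurable)
      (ae_of_all _ hC)
  simp_rw [divergence_matSymmTestField hM hζ hpot hχ hv hdiv, mul_add]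
  rw [integral_add hqA hqB,
    FunctionSpaces.Torus.integral_mul_convolution_comm hq hg hζ.continuous hζev]

end Divergence

/-! ## Diagonal kernels: the scalar objects of Duchon–Robert as a special case -/

section Diagonal

/-- The diagonal matrix kernel `δᵢⱼ K` of a scalar kernel `K`. [folklore] -/
def diagKernel (K : UnitAddTorus d → ℝ) : d → d → UnitAddTorus d → ℝ :=
  fun i j => if i = j then K else 0

omit [Fintype d] in
/-- Entries of the diagonal kernel. [folklore] -/
theorem diagKernel_apply (K : UnitAddTorus d → ℝ) (i j : d) :
    diagKernel K i j = if i = j then K else 0 :=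
  rfl

/-- For the diagonal kernel, the matrix mollification is the componentwise mollification:
`matConv v (δ K) = vecConv v K`. [folklore] -/
theorem matConv_diagKernel (v : UnitAddTorus d → EuclideanSpace ℝ d) (K : UnitAddTorus d → ℝ) :
    matConv v (diagKernel K) = vecConv v K := by
  funext x
  ext i
  rw [matConv_apply, vecConv_apply, Finset.sum_eq_single i]
  · rw [diagKernel_apply, if_pos rfl]
  · intro j _ hji
    rw [diagKernel_apply, if_neg (Ne.symm hji), convolution_zero]
    rfl
  · intro h
    exact absurd (Finset.mem_univ i) h

/-- For the diagonal kernel, the symmetric matrix field is Duchon–Robert's symmetric field: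
`matSymmTestField (δ K) χ v = symmTestField K χ v`. [folklore] -/
theorem matSymmTestField_diagKernel (K : UnitAddTorus d → ℝ) (χ : UnitAddTorus d → ℝ)
    (v : UnitAddTorus d → EuclideanSpace ℝ d) :
    matSymmTestField (diagKernel K) χ v = symmTestField K χ v := by
  funext x
  rw [matSymmTestField_apply, symmTestField_apply, matConv_diagKernel, matConv_diagKernel]

/-- For the diagonal kernel of a `C¹` scalar kernel, the matrix flux is Duchon–Robert's torus flux:
`∑ᵢⱼₖ ∂ₖ(δᵢⱼK) δvᵢδvⱼδvₖ = |δv|² ⟪∇K, δv⟫`, so `matKernelFlux (δ K) v = kernelFlux K v`. [folklore] -/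
theorem matKernelFlux_diagKernel {K : UnitAddTorus d → ℝ} (hK : FunctionSpaces.Torus.IsContDiff 1 K)
    (v : UnitAddTorus d → EuclideanSpace ℝ d) (x : UnitAddTorus d) :
    matKernelFlux (diagKernel K) v x = kernelFlux K v x := by
  rw [matKernelFlux, kernelFlux]
  refine integral_congr_ae (ae_of_all _ fun z => ?_)
  dsimp only
  set a : EuclideanSpace ℝ d := v (x + z) - v x with ha
  have h0 : ∀ k, FunctionSpaces.Torus.partialDeriv k (0 : UnitAddTorus d → ℝ) z = 0 := fun k => by
    simp [FunctionSpaces.Torus.partialDeriv, FunctionSpaces.Torus.lineDeriv]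
  have hentry : ∀ i j k, FunctionSpaces.Torus.partialDeriv k (diagKernel K i j) z * (a i * a j * a k) =
      (if i = j then 1 else 0) * (FunctionSpaces.Torus.partialDeriv k K z * (a i * a j * a k)) := by
    intro i j k
    by_cases hij : i = j
    · rw [diagKernel_apply, if_pos hij, if_pos hij, one_mul]
    · rw [diagKernel_apply, if_neg hij, if_neg hij, h0, zero_mul, zero_mul]
  simp_rw [hentry, ← Finset.mul_sum, boole_mul, Finset.sum_ite_eq, Finset.mem_univ, if_true]
  -- `∑ᵢ ∑ₖ ∂ₖK aᵢ aᵢ aₖ = ⟪∇K, a⟫ |a|²`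
  rw [PiLp.inner_apply, EuclideanSpace.real_norm_sq_eq, Finset.sum_mul_sum, Finset.sum_comm]
  refine Finset.sum_congr rfl fun i _ => Finset.sum_congr rfl fun k _ => ?_
  rw [RCLike.inner_apply, conj_trivial, FunctionSpaces.Torus.gradient_apply hK z i]
  ring

end Diagonal


end Literature.Analysis.FluidPDE.Torus
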